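import Mathlib.Data.Real.Basic
import Mathlib.Tactic.FieldSimp
import Mathlib.Tactic.Linarith
import Mathlib.Tactic.Ring
import Mathlib.Tactic.NormNum
import Mathlib.Tactic.Positivity
import Mathlib.Tactic.Push
import Mathlib.Tactic.ByContra
import HarnessLib

/-!
# FunctionalMining — K1-Q1 laminates: the SEXTIC two-point certificate `Bracket6 10 450 1178` and `chord_T6` (dict seat, staged; bank g5's (T6) blocks verbatim; Mathlib-only)

search for candidate a priori estimates; no regularity claim.  Static real algebra (no laminates, no matrices, no analysis); nothing about Navier–Stokes solutions; no literature claim.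

This is the (T6) analogue of `StretchingLaminateQuarticCert` (ao): the entry-free CONCAVITY CERTIFICATE for bank g5's
sextic supersolution `U₆ = |S|⁶ + (10|S|⁴ + 450|S|²M² + 1178M⁴)(M² − |ω|²)` (K1Q1-LAMINATE-CAP §2, hand variant (T6)),
which replaces the quartic `U₄ = |S|⁴ + (6|S|² + 24M²)(M² − |ω|²)` of (ao)/(ap) and lowers the kernel laminate cap from
`1.077708` (T4) to `1.021188` (T6) once composed with the tree half (`StretchingLaminateSextic`, (au)), the eigenframe
bridge (`StretchingLaminateSexticEigen`, (av)) and census-1 (A)'s kernel claim file V2 (`StretchingLaminateCapFinal6`, (aw)).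

**Parts A6 and A6b below are VERBATIM from bank g5's kernel scratch `pub-nsfunc-bank/LAMCAP-TREE.scratch.lean` v5 (2026-08-20T09:39:50Z, sha256[:16] 9ff62d392164e026, `import Mathlib`, farm rc 0 / 0 sorry per bank; authorship bank g5), re-homed from namespace `LamCapScratch` to `Laminate`; the only
edits are one `set_option linter.unusedVariables false in` prefix (`chord_T6`'s binder `hm0` is unused next to
`hmm`/`hmp`) and Mathlib's deprecation `push_neg ↦ push Not` (twice).**  Content (bank's wording): along a div-free segment `G + tB` the scalars
`q(t) = |S|²`, `m(t) = |ω|²` are quadratics with `q'' = γ = |w|²`, `m'' = 2γ`, `2α² ≤ qγ`, `β² ≤ mγ` (Cauchy–Schwarz);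
`U6line c₂ c₁ c₀ q m α β γ M t` is `U₆` along the line, `U6dd` its second derivative; `Bracket6 c₂ c₁ c₀` is the
pointwise statement `U₆'' ≤ 0` on `{m ≤ M²}`; `chord_T6 : Bracket6 → chord inequality
λ·U₆(G₊) + (1−λ)·U₆(G₋) ≤ U₆(G)` (exact chord identity `chord6_identity` + both children in the ball);
`bracket6_holds : Bracket6 10 450 1178` by AM–GM with a piecewise-constant weight `κ(q)` (7 intervals, affine in `m`,
14 univariate quadratics closed by `nlinarith`) and the scaling `U6dd_scale`.
search for candidate a priori estimates; no regularity claim.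
-/


namespace Summit.NavierStokesRegularity.FunctionalMining

namespace Laminate

/-! ## Part A6 — the SEXTIC supersolution U₆ = |S|⁶ + (c₂|S|⁴ + c₁|S|²M² + c₀M⁴)(M² − |ω|²): chord inequality from a POINTWISE bracket
hypothesis `Bracket6 c₂ c₁ c₀` (−U₆'' ≥ 0 along div-free segments inside {|ω|² ≤ M²}), via an exact positive 4-node quadrature of U₆''
(nodes 0, ¼, ½, ¾ of each side; weights 7/90, 4/15, 1/15, 4/45 — exact for quartic integrands against the hat kernel). -/

/-- `U₆` along the segment `t ↦ G + t·B`. -/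
noncomputable def U6line (c₂ c₁ c₀ q m α β γ M t : ℝ) : ℝ :=
  (q + 2 * α * t + γ / 2 * t ^ 2) ^ 3
    + (c₂ * (q + 2 * α * t + γ / 2 * t ^ 2) ^ 2 + c₁ * (q + 2 * α * t + γ / 2 * t ^ 2) * M ^ 2 + c₀ * M ^ 4)
      * (M ^ 2 - (m + 2 * β * t + γ * t ^ 2))

/-- `U₆''(t)` along the segment (exact second derivative). -/
noncomputable def U6dd (c₂ c₁ c₀ q m α β γ M t : ℝ) : ℝ :=
  6 * (q + 2 * α * t + γ / 2 * t ^ 2) * (2 * α + γ * t) ^ 2 + 3 * (q + 2 * α * t + γ / 2 * t ^ 2) ^ 2 * γ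
    + (2 * c₂ * (2 * α + γ * t) ^ 2 + (2 * c₂ * (q + 2 * α * t + γ / 2 * t ^ 2) + c₁ * M ^ 2) * γ)
      * (M ^ 2 - (m + 2 * β * t + γ * t ^ 2))
    - 2 * (2 * c₂ * (q + 2 * α * t + γ / 2 * t ^ 2) + c₁ * M ^ 2) * (2 * α + γ * t) * (2 * β + 2 * γ * t)
    - (c₂ * (q + 2 * α * t + γ / 2 * t ^ 2) ^ 2 + c₁ * (q + 2 * α * t + γ / 2 * t ^ 2) * M ^ 2 + c₀ * M ^ 4) * (2 * γ)

/-- **Exact 4+4-node quadrature identity** for the chord gap of the sextic `U₆` along a segment. -/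
theorem chord6_identity (c₂ c₁ c₀ q m α β γ M lam : ℝ) :
    lam * U6line c₂ c₁ c₀ q m α β γ M (1 - lam) + (1 - lam) * U6line c₂ c₁ c₀ q m α β γ M (-lam)
      - U6line c₂ c₁ c₀ q m α β γ M 0
    = lam * (1 - lam) ^ 2 * (7 / 90 * U6dd c₂ c₁ c₀ q m α β γ M 0 + 4 / 15 * U6dd c₂ c₁ c₀ q m α β γ M ((1 - lam) / 4)
        + 1 / 15 * U6dd c₂ c₁ c₀ q m α β γ M ((1 - lam) / 2) + 4 / 45 * U6dd c₂ c₁ c₀ q m α β γ M (3 * (1 - lam) / 4))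
      + (1 - lam) * lam ^ 2 * (7 / 90 * U6dd c₂ c₁ c₀ q m α β γ M 0 + 4 / 15 * U6dd c₂ c₁ c₀ q m α β γ M (-lam / 4)
        + 1 / 15 * U6dd c₂ c₁ c₀ q m α β γ M (-lam / 2) + 4 / 45 * U6dd c₂ c₁ c₀ q m α β γ M (-(3 * lam) / 4)) := by
  unfold U6line U6dd
  ring

/-- Translation along the segment: `U₆''(t)` is `U₆''(0)` of the shifted state. -/
theorem U6dd_shift (c₂ c₁ c₀ q m α β γ M t : ℝ) :
    U6dd c₂ c₁ c₀ q m α β γ M t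
      = U6dd c₂ c₁ c₀ (q + 2 * α * t + γ / 2 * t ^ 2) (m + 2 * β * t + γ * t ^ 2) (α + γ * t / 2) (β + γ * t) γ M 0 := by
  unfold U6dd
  ring

/-- **The pointwise bracket hypothesis** for the sextic: `U₆'' ≤ 0` at every admissible state (q = |S|² ≥ 0, 0 ≤ m = |ω|² ≤ M²,
γ = |w|² ≥ 0, Cauchy–Schwarz slacks `2⟨S,S_B⟩² ≤ |S|²|w|²`, `(ω·w)² ≤ |ω|²|w|²`).  Certified for (c₂,c₁,c₀) = (10,450,1178) and
(15,500,1450) by exact interval arithmetic (bank tools/lam/dual/certify_T6.py) and box-free by census-2; a kernel proof of it is the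
census seats' lane — here it is a hypothesis. -/
def Bracket6 (c₂ c₁ c₀ : ℝ) : Prop :=
  ∀ q m α β γ M : ℝ, 0 ≤ q → 0 ≤ m → m ≤ M ^ 2 → 0 ≤ γ → 2 * α ^ 2 ≤ q * γ → β ^ 2 ≤ m * γ →
    U6dd c₂ c₁ c₀ q m α β γ M 0 ≤ 0

/-- Bookkeeping step of this file's certificate (see the module docstring). [ours; elementary] -/
theorem quadq_nonneg_of_cs (q α γ t : ℝ) (hq : 0 ≤ q) (hγ : 0 ≤ γ) (hcs : 2 * α ^ 2 ≤ q * γ) :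
    0 ≤ q + 2 * α * t + γ / 2 * t ^ 2 := by
  rcases hγ.eq_or_lt with h | h
  · have hα2 : α ^ 2 = 0 := le_antisymm (by rw [← h] at hcs; nlinarith) (sq_nonneg α)
    have hα : α = 0 := pow_eq_zero_iff (n := 2) (by norm_num) |>.1 hα2
    rw [hα, ← h]; linarith
  · have e : (q + 2 * α * t + γ / 2 * t ^ 2) * γ = (q * γ - 2 * α ^ 2) + 2 * (α + γ * t / 2) ^ 2 := by ring
    by_contra hneg
    push Not at hneg
    have : (q + 2 * α * t + γ / 2 * t ^ 2) * γ < 0 := mul_neg_of_neg_of_pos hneg h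
    nlinarith [sq_nonneg (α + γ * t / 2)]

/-- Bookkeeping step of this file's certificate (see the module docstring). [ours; elementary] -/
theorem quadm_nonneg_of_cs (m β γ t : ℝ) (hm : 0 ≤ m) (hγ : 0 ≤ γ) (hcs : β ^ 2 ≤ m * γ) :
    0 ≤ m + 2 * β * t + γ * t ^ 2 := by
  rcases hγ.eq_or_lt with h | h
  · have hβ2 : β ^ 2 = 0 := le_antisymm (by rw [← h] at hcs; nlinarith) (sq_nonneg β)
    have hβ : β = 0 := pow_eq_zero_iff (n := 2) (by norm_num) |>.1 hβ2
    rw [hβ, ← h]; linarith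
  · have e : (m + 2 * β * t + γ * t ^ 2) * γ = (m * γ - β ^ 2) + (β + γ * t) ^ 2 := by ring
    by_contra hneg
    push Not at hneg
    have : (m + 2 * β * t + γ * t ^ 2) * γ < 0 := mul_neg_of_neg_of_pos hneg h
    nlinarith [sq_nonneg (β + γ * t)]

/-- Bookkeeping step of this file's certificate (see the module docstring). [ours; elementary] -/
theorem U6dd_node_nonpos {c₂ c₁ c₀ : ℝ} (hB : Bracket6 c₂ c₁ c₀) (q m α β γ M t : ℝ) (hq : 0 ≤ q) (hm : 0 ≤ m)
    (hγ : 0 ≤ γ) (hcs1 : 2 * α ^ 2 ≤ q * γ) (hcs2 : β ^ 2 ≤ m * γ) (hmt : m + 2 * β * t + γ * t ^ 2 ≤ M ^ 2) :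
    U6dd c₂ c₁ c₀ q m α β γ M t ≤ 0 := by
  rw [U6dd_shift]
  apply hB
  · exact quadq_nonneg_of_cs q α γ t hq hγ hcs1
  · exact quadm_nonneg_of_cs m β γ t hm hγ hcs2
  · exact hmt
  · exact hγ
  · have e : (q + 2 * α * t + γ / 2 * t ^ 2) * γ - 2 * (α + γ * t / 2) ^ 2 = q * γ - 2 * α ^ 2 := by ring
    linarith
  · have e : (m + 2 * β * t + γ * t ^ 2) * γ - (β + γ * t) ^ 2 = m * γ - β ^ 2 := by ring
    linarith

set_option linter.unusedVariables false in
/-- **(T6) chord inequality**: under the bracket hypothesis, `U₆` is concave along every admissible div-free segment. -/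
theorem chord_T6 {c₂ c₁ c₀ : ℝ} (hB : Bracket6 c₂ c₁ c₀) (q m α β γ M lam : ℝ) (hq : 0 ≤ q) (hmnn : 0 ≤ m)
    (hγ : 0 ≤ γ) (hcs1 : 2 * α ^ 2 ≤ q * γ) (hcs2 : β ^ 2 ≤ m * γ) (h0 : 0 ≤ lam) (h1 : lam ≤ 1)
    (hmp : m + 2 * β * (1 - lam) + γ * (1 - lam) ^ 2 ≤ M ^ 2) (hmm : m + 2 * β * (-lam) + γ * (-lam) ^ 2 ≤ M ^ 2)
    (hm0 : m ≤ M ^ 2) :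
    lam * U6line c₂ c₁ c₀ q m α β γ M (1 - lam) + (1 - lam) * U6line c₂ c₁ c₀ q m α β γ M (-lam)
      ≤ U6line c₂ c₁ c₀ q m α β γ M 0 := by
  have node : ∀ t : ℝ, m + 2 * β * t + γ * t ^ 2 ≤ M ^ 2 → U6dd c₂ c₁ c₀ q m α β γ M t ≤ 0 :=
    fun t ht => U6dd_node_nonpos hB q m α β γ M t hq hmnn hγ hcs1 hcs2 ht
  have hgp : 0 ≤ γ * (1 - lam) ^ 2 := mul_nonneg hγ (sq_nonneg _)
  have hgm : 0 ≤ γ * lam ^ 2 := mul_nonneg hγ (sq_nonneg _)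
  have s0 := node 0 (by nlinarith [hm0])
  have s1 := node ((1 - lam) / 4) (by nlinarith [hmp, hm0, hgp])
  have s2 := node ((1 - lam) / 2) (by nlinarith [hmp, hm0, hgp])
  have s3 := node (3 * (1 - lam) / 4) (by nlinarith [hmp, hm0, hgp])
  have s4 := node (-lam / 4) (by nlinarith [hmm, hm0, hgm])
  have s5 := node (-lam / 2) (by nlinarith [hmm, hm0, hgm])
  have s6 := node (-(3 * lam) / 4) (by nlinarith [hmm, hm0, hgm])
  have w1 : 0 ≤ lam * (1 - lam) ^ 2 := mul_nonneg h0 (sq_nonneg _)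
  have w2 : 0 ≤ (1 - lam) * lam ^ 2 := mul_nonneg (by linarith) (sq_nonneg _)
  have sumP : 7 / 90 * U6dd c₂ c₁ c₀ q m α β γ M 0 + 4 / 15 * U6dd c₂ c₁ c₀ q m α β γ M ((1 - lam) / 4)
      + 1 / 15 * U6dd c₂ c₁ c₀ q m α β γ M ((1 - lam) / 2) + 4 / 45 * U6dd c₂ c₁ c₀ q m α β γ M (3 * (1 - lam) / 4) ≤ 0 := by
    linarith
  have sumM : 7 / 90 * U6dd c₂ c₁ c₀ q m α β γ M 0 + 4 / 15 * U6dd c₂ c₁ c₀ q m α β γ M (-lam / 4)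
      + 1 / 15 * U6dd c₂ c₁ c₀ q m α β γ M (-lam / 2) + 4 / 45 * U6dd c₂ c₁ c₀ q m α β γ M (-(3 * lam) / 4) ≤ 0 := by
    linarith
  have e := chord6_identity c₂ c₁ c₀ q m α β γ M lam
  nlinarith [mul_nonneg w1 (neg_nonneg.2 sumP), mul_nonneg w2 (neg_nonneg.2 sumM)]

/-! ## Part A6b — KERNEL PROOF of the sextic bracket `Bracket6 10 450 1178` (the (T6) concavity of K1Q1-LAMINATE-CAP §2):
AM–GM with a piecewise-constant weight κ(q) (7 intervals), which makes the bound AFFINE in m, then 14 univariate quadratics. -/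

/-- `A(q,m)` of the reduction (M = 1). -/
noncomputable def RkA (c₂ c₁ c₀ q m : ℝ) : ℝ :=
  -3 * q ^ 2 - (2 * c₂ * q + c₁) * (1 - m) + 2 * (c₂ * q ^ 2 + c₁ * q + c₀)

/-- `R(q,m;κ) = A − (B + Cκ/2)·q/2 − C·m/(2κ)` with `B = 24q + 8c₂(1−m)`, `C = 8(2c₂q + c₁)`. -/
noncomputable def Rk (c₂ c₁ c₀ q m κ : ℝ) : ℝ :=
  RkA c₂ c₁ c₀ q m - (24 * q + 8 * c₂ * (1 - m) + 8 * (2 * c₂ * q + c₁) * κ / 2) * q / 2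
    - 8 * (2 * c₂ * q + c₁) * m / (2 * κ)

/-- **AM–GM reduction**: for every `κ > 0`, `−U₆''(0) ≥ |w|²·R(q,m;κ)` (M = 1). -/
theorem bracket_reduce (c₂ c₁ c₀ q m α β γ κ : ℝ) (hκ : 0 < κ) (hq : 0 ≤ q) (hm1 : m ≤ 1) (hc2 : 0 ≤ c₂)
    (hC : 0 ≤ 2 * c₂ * q + c₁) (hcs1 : 2 * α ^ 2 ≤ q * γ) (hcs2 : β ^ 2 ≤ m * γ) :
    U6dd c₂ c₁ c₀ q m α β γ 1 0 ≤ -(γ * Rk c₂ c₁ c₀ q m κ) := by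
  have hκ' : κ ≠ 0 := ne_of_gt hκ
  have e : κ * (-(U6dd c₂ c₁ c₀ q m α β γ 1 0) - γ * Rk c₂ c₁ c₀ q m κ)
      = κ * (24 * q + 8 * c₂ * (1 - m)) * (q * γ / 2 - α ^ 2)
        + (8 * (2 * c₂ * q + c₁)) * κ ^ 2 / 2 * (q * γ / 2 - α ^ 2)
        + (8 * (2 * c₂ * q + c₁)) / 2 * (m * γ - β ^ 2)
        + (8 * (2 * c₂ * q + c₁)) / 2 * (κ * α + β) ^ 2 := by
    unfold U6dd Rk RkA
    field_simp
    ring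
  have hB : 0 ≤ 24 * q + 8 * c₂ * (1 - m) := by nlinarith
  have t1 : 0 ≤ κ * (24 * q + 8 * c₂ * (1 - m)) * (q * γ / 2 - α ^ 2) :=
    mul_nonneg (mul_nonneg hκ.le hB) (by linarith)
  have t2 : 0 ≤ (8 * (2 * c₂ * q + c₁)) * κ ^ 2 / 2 * (q * γ / 2 - α ^ 2) :=
    mul_nonneg (div_nonneg (mul_nonneg (by linarith) (sq_nonneg κ)) (by norm_num)) (by linarith)
  have t3 : 0 ≤ (8 * (2 * c₂ * q + c₁)) / 2 * (m * γ - β ^ 2) := mul_nonneg (by linarith) (by linarith)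
  have t4 : 0 ≤ (8 * (2 * c₂ * q + c₁)) / 2 * (κ * α + β) ^ 2 := mul_nonneg (by linarith) (sq_nonneg _)
  have hsum : 0 ≤ κ * (-(U6dd c₂ c₁ c₀ q m α β γ 1 0) - γ * Rk c₂ c₁ c₀ q m κ) := by rw [e]; linarith
  have h2 := (mul_nonneg_iff_of_pos_left hκ).1 hsum
  linarith

/-- Bookkeeping step of this file's certificate (see the module docstring). [ours; elementary] -/
theorem Rk_affine (c₂ c₁ c₀ q m κ : ℝ) :
    Rk c₂ c₁ c₀ q m κ = (1 - m) * Rk c₂ c₁ c₀ q 0 κ + m * Rk c₂ c₁ c₀ q 1 κ := by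
  unfold Rk RkA; ring

/-- Bookkeeping step of this file's certificate (see the module docstring). [ours; elementary] -/
theorem Rk0_eq (q κ : ℝ) : Rk 10 450 1178 q 0 κ = 5 * q ^ 2 + 840 * q + 1906 - 2 * κ * (20 * q ^ 2 + 450 * q) := by
  unfold Rk RkA; ring

/-- Bookkeeping step of this file's certificate (see the module docstring). [ours; elementary] -/
theorem Rk1_eq (q κ : ℝ) (hκ : κ ≠ 0) :
    Rk 10 450 1178 q 1 κ = 5 * q ^ 2 + 900 * q + 2356 - 2 * κ * (20 * q ^ 2 + 450 * q) - 4 * (20 * q + 450) / κ := by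
  unfold Rk RkA; field_simp; ring

/-- **The (T6) bracket at M = 1.** -/
theorem bracket6_one (q m α β γ : ℝ) (hq : 0 ≤ q) (hm : 0 ≤ m) (hm1 : m ≤ 1) (hγ : 0 ≤ γ)
    (hcs1 : 2 * α ^ 2 ≤ q * γ) (hcs2 : β ^ 2 ≤ m * γ) :
    U6dd 10 450 1178 q m α β γ 1 0 ≤ 0 := by
  have hC : 0 ≤ 2 * 10 * q + 450 := by linarith
  have main : ∀ κ : ℝ, 0 < κ → 0 ≤ Rk 10 450 1178 q 0 κ → 0 ≤ Rk 10 450 1178 q 1 κ →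
      U6dd 10 450 1178 q m α β γ 1 0 ≤ 0 := by
    intro κ hκ h0 h1
    have hr := bracket_reduce 10 450 1178 q m α β γ κ hκ hq hm1 (by norm_num) hC hcs1 hcs2
    have hR : 0 ≤ Rk 10 450 1178 q m κ := by
      rw [Rk_affine]; exact add_nonneg (mul_nonneg (by linarith) h0) (mul_nonneg hm h1)
    nlinarith [mul_nonneg hγ hR]
  rcases le_or_gt q (33/8) with hc0 | hc0
  · apply main (49/64) (by norm_num)
    · rw [Rk0_eq]; nlinarith [mul_nonneg hq (by linarith : (0:ℝ) ≤ 33/8 - q)]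
    · rw [Rk1_eq _ _ (by norm_num)]; nlinarith [mul_nonneg hq (by linarith : (0:ℝ) ≤ 33/8 - q)]
  rcases le_or_gt q (49/8) with hc1 | hc1
  · apply main (63/100) (by norm_num)
    · rw [Rk0_eq]; nlinarith [mul_nonneg (by linarith : (0:ℝ) ≤ q - 33/8) (by linarith : (0:ℝ) ≤ 49/8 - q)]
    · rw [Rk1_eq _ _ (by norm_num)]; nlinarith [mul_nonneg (by linarith : (0:ℝ) ≤ q - 33/8) (by linarith : (0:ℝ) ≤ 49/8 - q)]
  rcases le_or_gt q (23/2) with hc2 | hc2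
  · apply main (13/25) (by norm_num)
    · rw [Rk0_eq]; nlinarith [mul_nonneg (by linarith : (0:ℝ) ≤ q - 49/8) (by linarith : (0:ℝ) ≤ 23/2 - q)]
    · rw [Rk1_eq _ _ (by norm_num)]; nlinarith [mul_nonneg (by linarith : (0:ℝ) ≤ q - 49/8) (by linarith : (0:ℝ) ≤ 23/2 - q)]
  rcases le_or_gt q (61/2) with hc3 | hc3
  · apply main (17/50) (by norm_num)
    · rw [Rk0_eq]; nlinarith [mul_nonneg (by linarith : (0:ℝ) ≤ q - 23/2) (by linarith : (0:ℝ) ≤ 61/2 - q)]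
    · rw [Rk1_eq _ _ (by norm_num)]; nlinarith [mul_nonneg (by linarith : (0:ℝ) ≤ q - 23/2) (by linarith : (0:ℝ) ≤ 61/2 - q)]
  rcases le_or_gt q (627/8) with hc4 | hc4
  · apply main (1/5) (by norm_num)
    · rw [Rk0_eq]; nlinarith [mul_nonneg (by linarith : (0:ℝ) ≤ q - 61/2) (by linarith : (0:ℝ) ≤ 627/8 - q)]
    · rw [Rk1_eq _ _ (by norm_num)]; nlinarith [mul_nonneg (by linarith : (0:ℝ) ≤ q - 61/2) (by linarith : (0:ℝ) ≤ 627/8 - q)]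
  rcases le_or_gt q (1525/2) with hc5 | hc5
  · apply main (13/100) (by norm_num)
    · rw [Rk0_eq]; nlinarith [mul_nonneg (by linarith : (0:ℝ) ≤ q - 627/8) (by linarith : (0:ℝ) ≤ 1525/2 - q)]
    · rw [Rk1_eq _ _ (by norm_num)]; nlinarith [mul_nonneg (by linarith : (0:ℝ) ≤ q - 627/8) (by linarith : (0:ℝ) ≤ 1525/2 - q)]
  -- tail: q > 1525/2, κ = 1/10 (convex; both quadratics dominated by q²)
  apply main (1 / 10) (by norm_num)
  · rw [Rk0_eq]; nlinarith [mul_nonneg hq (by linarith : (0:ℝ) ≤ q - 1525/2)]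
  · rw [Rk1_eq _ _ (by norm_num)]; nlinarith [mul_nonneg hq (by linarith : (0:ℝ) ≤ q - 1525/2)]

/-- Scaling `G ↦ G/M` of `U₆''(0)`. -/
theorem U6dd_scale (c₂ c₁ c₀ q m α β γ M : ℝ) (hM : M ≠ 0) :
    U6dd c₂ c₁ c₀ q m α β γ M 0
      = M ^ 6 * U6dd c₂ c₁ c₀ (q / M ^ 2) (m / M ^ 2) (α / M ^ 2) (β / M ^ 2) (γ / M ^ 2) 1 0 := by
  unfold U6dd
  field_simp
  try ring

/-- **THE (T6) BRACKET, KERNEL-CHECKED**: `Bracket6 10 450 1178` — U₆ = |S|⁶ + (10|S|⁴ + 450|S|²M² + 1178M⁴)(M² − |ω|²) is concave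
along every admissible div-free segment (the input of `chord_T6`). -/
theorem bracket6_holds : Bracket6 10 450 1178 := by
  intro q m α β γ M hq hm hmM hγ hcs1 hcs2
  rcases eq_or_ne M 0 with hM0 | hM
  · subst hM0
    have hm0 : m = 0 := le_antisymm (by simpa using hmM) hm
    subst hm0
    have hβ2 : β ^ 2 = 0 := le_antisymm (by simpa using hcs2) (sq_nonneg β)
    have hβ : β = 0 := pow_eq_zero_iff (n := 2) (by norm_num) |>.1 hβ2
    subst hβ
    unfold U6dd
    nlinarith [mul_le_mul_of_nonneg_left hcs1 (by linarith : (0:ℝ) ≤ 12 * q), mul_nonneg (mul_nonneg hq hq) hγ]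
  · have hM2 : 0 < M ^ 2 := by positivity
    have hM4 : 0 < M ^ 2 * M ^ 2 := by positivity
    have hcs1' : 2 * (α / M ^ 2) ^ 2 ≤ (q / M ^ 2) * (γ / M ^ 2) := by
      rw [show 2 * (α / M ^ 2) ^ 2 = 2 * α ^ 2 * (1 / (M ^ 2 * M ^ 2)) by field_simp,
        show (q / M ^ 2) * (γ / M ^ 2) = q * γ * (1 / (M ^ 2 * M ^ 2)) by field_simp]
      exact mul_le_mul_of_nonneg_right hcs1 (by positivity)
    have hcs2' : (β / M ^ 2) ^ 2 ≤ (m / M ^ 2) * (γ / M ^ 2) := by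
      rw [show (β / M ^ 2) ^ 2 = β ^ 2 * (1 / (M ^ 2 * M ^ 2)) by field_simp,
        show (m / M ^ 2) * (γ / M ^ 2) = m * γ * (1 / (M ^ 2 * M ^ 2)) by field_simp]
      exact mul_le_mul_of_nonneg_right hcs2 (by positivity)
    have key := bracket6_one (q / M ^ 2) (m / M ^ 2) (α / M ^ 2) (β / M ^ 2) (γ / M ^ 2)
      (div_nonneg hq hM2.le) (div_nonneg hm hM2.le) (by rwa [div_le_one hM2]) (div_nonneg hγ hM2.le) hcs1' hcs2'
    rw [U6dd_scale 10 450 1178 q m α β γ M hM]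
    exact mul_nonpos_iff.2 (Or.inl ⟨by positivity, key⟩)

end Laminate

end Summit.NavierStokesRegularity.FunctionalMining
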